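import Summits.BirchSwinnertonDyer.BirchSwinnertonDyer.Theorems.Rank2ObservatoryRank2Table
import Summits.BirchSwinnertonDyer.BirchSwinnertonDyer.Theorems.Rank2ObservatoryRank2Rows20a
import Summits.BirchSwinnertonDyer.BirchSwinnertonDyer.Theorems.Rank2ObservatoryRank2Rows20b
import Summits.BirchSwinnertonDyer.BirchSwinnertonDyer.Theorems.Rank2ObservatoryRank2Rows21a
import Summits.BirchSwinnertonDyer.BirchSwinnertonDyer.Theorems.Rank2ObservatoryRank2Rows21b
import Summits.BirchSwinnertonDyer.BirchSwinnertonDyer.Theorems.Rank2ObservatoryRank2Rows22a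
import Summits.BirchSwinnertonDyer.BirchSwinnertonDyer.Theorems.Rank2ObservatoryRank2Rows22b
import Summits.BirchSwinnertonDyer.BirchSwinnertonDyer.Theorems.Rank2ObservatoryRank2Rows23a
import Summits.BirchSwinnertonDyer.BirchSwinnertonDyer.Theorems.Rank2ObservatoryRank2Rows23b
import Summits.BirchSwinnertonDyer.BirchSwinnertonDyer.Theorems.Rank2ObservatoryRank2Rows24a
import Summits.BirchSwinnertonDyer.BirchSwinnertonDyer.Theorems.Rank2ObservatoryRank2Rows24b
import Summits.BirchSwinnertonDyer.BirchSwinnertonDyer.Theorems.Rank2ObservatoryRank2Rows25a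
import Summits.BirchSwinnertonDyer.BirchSwinnertonDyer.Theorems.Rank2ObservatoryRank2Rows25b
import Summits.BirchSwinnertonDyer.BirchSwinnertonDyer.Theorems.Rank2ObservatoryRank2Rows26a
import Summits.BirchSwinnertonDyer.BirchSwinnertonDyer.Theorems.Rank2ObservatoryRank2Rows26b
import Summits.BirchSwinnertonDyer.BirchSwinnertonDyer.Theorems.Rank2ObservatoryRank2Rows27a
import Summits.BirchSwinnertonDyer.BirchSwinnertonDyer.Theorems.Rank2ObservatoryRank2Rows27b
import Summits.BirchSwinnertonDyer.BirchSwinnertonDyer.Theorems.Rank2ObservatoryRank2Rows28a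
import Summits.BirchSwinnertonDyer.BirchSwinnertonDyer.Theorems.Rank2ObservatoryRank2Rows28b
import Summits.BirchSwinnertonDyer.BirchSwinnertonDyer.Theorems.Rank2ObservatoryRank2Rows29a
import Summits.BirchSwinnertonDyer.BirchSwinnertonDyer.Theorems.Rank2ObservatoryRank2Rows29b
import HarnessLib

/-!
# BirchSwinnertonDyer — rank ≥ 2 observatory: rank-2 census table, decade 2 of 10 (`100000 ≤ N < 150000`)

HONEST FRAMING: per-curve certified theorems and census instruments; no claim on BSD in rank ≥ 2.

Machine-written AGGREGATION level of the rank-2 census (schema `Rank2ObservatoryRank2Table.lean`, data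
chunks `Rank2ObservatoryRank2Rows20a … 29b`, census `Rank2ObservatoryRank2Census.lean`): `rank2Decade2` is the
concatenation of the 20 chunks of conductor windows 20–29 (`100000 ≤ N < 150000`; a window above the gate's
200 kB file cap is stored as two half-window chunks `NNa`, `NNb`) — rows 56976–91549 of `rank2_table.tsv`
(sha256 `8b151c933b69ee8dae4834c21efd171353ae94c887716c05b7381d12d173f912`), 34574 curves from `100005a1` to
`149985g1`. Its theorems are assembled from the chunk theorems (each a kernel `decide`) by
`List.all_append` / `List.length_append` rewriting only; no row is re-evaluated here. The two-level
assembly (chunks → decades → table) keeps every file under the tree's 400-line limit and every list short.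

Reference: J. E. Cremona, *Algorithms for Modular Elliptic Curves* (2nd ed. 1997), tables / ecdata.
-/

-- single-conjunct summit: `Summit.BirchSwinnertonDyer.BirchSwinnertonDyer.…` repeats the name by design
set_option linter.dupNamespace false

namespace Summit.BirchSwinnertonDyer.BirchSwinnertonDyer.Rank2Observatory

/-- The 20 chunks of decade 2 (conductors `100000 ≤ N < 150000`), in order. [cite: CremonaAlgorithms1997, Tables] -/
noncomputable def rank2Decade2Chunks : List (List Rank2Row) := [
  rank2Rows20a, rank2Rows20b, rank2Rows21a, rank2Rows21b, rank2Rows22a, rank2Rows22b,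
  rank2Rows23a, rank2Rows23b, rank2Rows24a, rank2Rows24b, rank2Rows25a, rank2Rows25b,
  rank2Rows26a, rank2Rows26b, rank2Rows27a, rank2Rows27b, rank2Rows28a, rank2Rows28b,
  rank2Rows29a, rank2Rows29b]

/-- Decade 2 of the rank-2 census table: the 34574 rank-2 curves of conductor `100000 ≤ N < 150000` (rows 56976–91549).
[cite: CremonaAlgorithms1997, Tables] -/
noncomputable def rank2Decade2 : List Rank2Row :=
  rank2Decade2Chunks.flatten

/-- Every row of decade 2 satisfies `Rank2Row.check` (from the 20 chunk theorems). [folklore] -/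
theorem rank2Decade2_check : rank2Decade2.all Rank2Row.check = true := by
  simp only [rank2Decade2, rank2Decade2Chunks, List.flatten_cons, List.flatten_nil, List.all_append, List.all_nil,
    Bool.and_true,
    rank2Rows20a_check, rank2Rows20b_check, rank2Rows21a_check, rank2Rows21b_check,
    rank2Rows22a_check, rank2Rows22b_check, rank2Rows23a_check, rank2Rows23b_check,
    rank2Rows24a_check, rank2Rows24b_check, rank2Rows25a_check, rank2Rows25b_check,
    rank2Rows26a_check, rank2Rows26b_check, rank2Rows27a_check, rank2Rows27b_check,
    rank2Rows28a_check, rank2Rows28b_check, rank2Rows29a_check, rank2Rows29b_check]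

/-- Decade 2 has `34574` rows (sum of the 20 kernel-counted chunk lengths). [cite: CremonaAlgorithms1997, Tables] -/
theorem rank2Decade2_length : rank2Decade2.length = 34574 := by
  simp only [rank2Decade2, rank2Decade2Chunks, List.flatten_cons, List.flatten_nil, List.length_append, List.length_nil,
    rank2Rows20a_length, rank2Rows20b_length, rank2Rows21a_length, rank2Rows21b_length,
    rank2Rows22a_length, rank2Rows22b_length, rank2Rows23a_length, rank2Rows23b_length,
    rank2Rows24a_length, rank2Rows24b_length, rank2Rows25a_length, rank2Rows25b_length,
    rank2Rows26a_length, rank2Rows26b_length, rank2Rows27a_length, rank2Rows27b_length,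
    rank2Rows28a_length, rank2Rows28b_length, rank2Rows29a_length, rank2Rows29b_length]

/-- Every conductor of decade 2 is `< 500 000` (from the 20 kernel-checked chunk ranges).
[cite: CremonaAlgorithms1997, Tables] -/
theorem rank2Decade2_conductor_lt : rank2Decade2.all (fun r => decide (r.N < 500000)) = true := by
  simp only [rank2Decade2, rank2Decade2Chunks, List.flatten_cons, List.flatten_nil, List.all_append, List.all_nil,
    Bool.and_true,
    Rank2Row.all_conductorLt_of_all_range (by norm_num) rank2Rows20a_conductor,
    Rank2Row.all_conductorLt_of_all_range (by norm_num) rank2Rows20b_conductor,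
    Rank2Row.all_conductorLt_of_all_range (by norm_num) rank2Rows21a_conductor,
    Rank2Row.all_conductorLt_of_all_range (by norm_num) rank2Rows21b_conductor,
    Rank2Row.all_conductorLt_of_all_range (by norm_num) rank2Rows22a_conductor,
    Rank2Row.all_conductorLt_of_all_range (by norm_num) rank2Rows22b_conductor,
    Rank2Row.all_conductorLt_of_all_range (by norm_num) rank2Rows23a_conductor,
    Rank2Row.all_conductorLt_of_all_range (by norm_num) rank2Rows23b_conductor,
    Rank2Row.all_conductorLt_of_all_range (by norm_num) rank2Rows24a_conductor,
    Rank2Row.all_conductorLt_of_all_range (by norm_num) rank2Rows24b_conductor,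
    Rank2Row.all_conductorLt_of_all_range (by norm_num) rank2Rows25a_conductor,
    Rank2Row.all_conductorLt_of_all_range (by norm_num) rank2Rows25b_conductor,
    Rank2Row.all_conductorLt_of_all_range (by norm_num) rank2Rows26a_conductor,
    Rank2Row.all_conductorLt_of_all_range (by norm_num) rank2Rows26b_conductor,
    Rank2Row.all_conductorLt_of_all_range (by norm_num) rank2Rows27a_conductor,
    Rank2Row.all_conductorLt_of_all_range (by norm_num) rank2Rows27b_conductor,
    Rank2Row.all_conductorLt_of_all_range (by norm_num) rank2Rows28a_conductor,
    Rank2Row.all_conductorLt_of_all_range (by norm_num) rank2Rows28b_conductor,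
    Rank2Row.all_conductorLt_of_all_range (by norm_num) rank2Rows29a_conductor,
    Rank2Row.all_conductorLt_of_all_range (by norm_num) rank2Rows29b_conductor]

/-- A row of a chunk of decade 2 is a row of the decade. [folklore] -/
theorem mem_rank2Decade2_of_mem_chunk {l : List Rank2Row} (hl : l ∈ rank2Decade2Chunks) {r : Rank2Row} (hr : r ∈ l) :
    r ∈ rank2Decade2 :=
  List.mem_flatten.mpr ⟨l, hl, hr⟩

/-- Chunk 20a is a chunk of decade 2. [folklore] -/
theorem rank2Rows20a_mem_decade2 : rank2Rows20a ∈ rank2Decade2Chunks :=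
  List.mem_iff_getElem?.mpr ⟨0, rfl⟩

/-- Chunk 20b is a chunk of decade 2. [folklore] -/
theorem rank2Rows20b_mem_decade2 : rank2Rows20b ∈ rank2Decade2Chunks :=
  List.mem_iff_getElem?.mpr ⟨1, rfl⟩

/-- Chunk 21a is a chunk of decade 2. [folklore] -/
theorem rank2Rows21a_mem_decade2 : rank2Rows21a ∈ rank2Decade2Chunks :=
  List.mem_iff_getElem?.mpr ⟨2, rfl⟩

/-- Chunk 21b is a chunk of decade 2. [folklore] -/
theorem rank2Rows21b_mem_decade2 : rank2Rows21b ∈ rank2Decade2Chunks :=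
  List.mem_iff_getElem?.mpr ⟨3, rfl⟩

/-- Chunk 22a is a chunk of decade 2. [folklore] -/
theorem rank2Rows22a_mem_decade2 : rank2Rows22a ∈ rank2Decade2Chunks :=
  List.mem_iff_getElem?.mpr ⟨4, rfl⟩

/-- Chunk 22b is a chunk of decade 2. [folklore] -/
theorem rank2Rows22b_mem_decade2 : rank2Rows22b ∈ rank2Decade2Chunks :=
  List.mem_iff_getElem?.mpr ⟨5, rfl⟩

/-- Chunk 23a is a chunk of decade 2. [folklore] -/
theorem rank2Rows23a_mem_decade2 : rank2Rows23a ∈ rank2Decade2Chunks :=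
  List.mem_iff_getElem?.mpr ⟨6, rfl⟩

/-- Chunk 23b is a chunk of decade 2. [folklore] -/
theorem rank2Rows23b_mem_decade2 : rank2Rows23b ∈ rank2Decade2Chunks :=
  List.mem_iff_getElem?.mpr ⟨7, rfl⟩

/-- Chunk 24a is a chunk of decade 2. [folklore] -/
theorem rank2Rows24a_mem_decade2 : rank2Rows24a ∈ rank2Decade2Chunks :=
  List.mem_iff_getElem?.mpr ⟨8, rfl⟩

/-- Chunk 24b is a chunk of decade 2. [folklore] -/
theorem rank2Rows24b_mem_decade2 : rank2Rows24b ∈ rank2Decade2Chunks :=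
  List.mem_iff_getElem?.mpr ⟨9, rfl⟩

/-- Chunk 25a is a chunk of decade 2. [folklore] -/
theorem rank2Rows25a_mem_decade2 : rank2Rows25a ∈ rank2Decade2Chunks :=
  List.mem_iff_getElem?.mpr ⟨10, rfl⟩

/-- Chunk 25b is a chunk of decade 2. [folklore] -/
theorem rank2Rows25b_mem_decade2 : rank2Rows25b ∈ rank2Decade2Chunks :=
  List.mem_iff_getElem?.mpr ⟨11, rfl⟩

/-- Chunk 26a is a chunk of decade 2. [folklore] -/
theorem rank2Rows26a_mem_decade2 : rank2Rows26a ∈ rank2Decade2Chunks :=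
  List.mem_iff_getElem?.mpr ⟨12, rfl⟩

/-- Chunk 26b is a chunk of decade 2. [folklore] -/
theorem rank2Rows26b_mem_decade2 : rank2Rows26b ∈ rank2Decade2Chunks :=
  List.mem_iff_getElem?.mpr ⟨13, rfl⟩

/-- Chunk 27a is a chunk of decade 2. [folklore] -/
theorem rank2Rows27a_mem_decade2 : rank2Rows27a ∈ rank2Decade2Chunks :=
  List.mem_iff_getElem?.mpr ⟨14, rfl⟩

/-- Chunk 27b is a chunk of decade 2. [folklore] -/
theorem rank2Rows27b_mem_decade2 : rank2Rows27b ∈ rank2Decade2Chunks :=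
  List.mem_iff_getElem?.mpr ⟨15, rfl⟩

/-- Chunk 28a is a chunk of decade 2. [folklore] -/
theorem rank2Rows28a_mem_decade2 : rank2Rows28a ∈ rank2Decade2Chunks :=
  List.mem_iff_getElem?.mpr ⟨16, rfl⟩

/-- Chunk 28b is a chunk of decade 2. [folklore] -/
theorem rank2Rows28b_mem_decade2 : rank2Rows28b ∈ rank2Decade2Chunks :=
  List.mem_iff_getElem?.mpr ⟨17, rfl⟩

/-- Chunk 29a is a chunk of decade 2. [folklore] -/
theorem rank2Rows29a_mem_decade2 : rank2Rows29a ∈ rank2Decade2Chunks :=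
  List.mem_iff_getElem?.mpr ⟨18, rfl⟩

/-- Chunk 29b is a chunk of decade 2. [folklore] -/
theorem rank2Rows29b_mem_decade2 : rank2Rows29b ∈ rank2Decade2Chunks :=
  List.mem_iff_getElem?.mpr ⟨19, rfl⟩

end Summit.BirchSwinnertonDyer.BirchSwinnertonDyer.Rank2Observatory
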